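import Summits.QuantumFields.YangMills.Theorems.UnitScaleTiltCoverFlatG
import Summits.QuantumFields.YangMills.Theorems.UnitScaleTiltCoverAveragesRange
import HarnessLib

/-!
# Route `UnitScaleTilt`, crux K1 child «MinimiserStabilityRegPr» (stmt-QuantumFields-19200), registered stub `stub_halvingStep` (H), branch (P2-small),
# mechanism of record **(α) COVERING ∕ PERIODISATION** (OWNER RULING g26-№18) — file `CoverFlatHKey`: **THE KEY LEMMA, UNCONDITIONAL — `flatH_cover`, `flatGt_cover`,
# `GE_cover`**: the four multi-scale average identities of ✓`CoverFlatH.flatH_cover_of` DISCHARGED from LEAD `ym-ust-19200-w5` g3's range-restricted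
# ✓`CoverAverages.bondAvgIter_compR∕bondAvgIter_pushR∕siteAvgIter_compR∕siteAvgIter_pushR` at `φ i := proj (F.P K) jc i` (✓α1 `proj_shift_cast`∕`proj_blockOf`∕
# `proj_blockSite_cast`) — the 13:00Z trigger object of RULING g26-№18∕ACK 28 (cross-check: LEAD's HOME draft `CoverFlatHKey-DRAFT-w5g3.lean` proves `flatH_cover` in ns `CoverFlatOps`
# by the same instantiation)

Cell `ym3-torus` (HUMAN RULING D-0037, YM ladder rung R3 — continuum SU(2) YM₃ on the torus is a RUNG, not the Clay problem), width seat `ym-ust-20520-w1` gen 5.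
`--supports stmt-QuantumFields-19200 --as helper`; def-free, 0 sorry, standard axioms.

* §1 THE FOUR IDENTITIES AT `proj` ([Balaban1984PropagatorsI] (1.18)∕(1.20) through the covering map): `bondAvgIter_comp_proj`, `bondAvgIter_push_proj`, `siteAvgIter_comp_proj`,
  `siteAvgIter_push_proj` — exactly the `hbpull∕hbpush∕hspull∕hspush` binders of ✓`CoverFlatH`∕✓`CoverFlatG`.
* §2 ★★★`flatH_cover : flatH (F.cover jc) n K (D.comap jc) (X ∘ projIdx D jc) bt = flatH F n K D X (projBond (F.P K) jc 0 bt)`; ★`isFlatH_cover` (any two `IsFlatH`-pinned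
  operators — α5's `hH`), ★`isFlatGt_cover` (α5's `hGt`), ★`GE_cover`∕`isFlatGW_cover` (ACK 31 (2), the (P-2) G-band port).
HONEST SCOPE: linear algebra over landed bricks; NOT a claim about the H stub, the crux, the rung or a mass gap (α6∕α7 = the `_allSizes` ports, other hands).

References: T. Bałaban, CMP **96** (1984) 223–250 [Balaban1984PropagatorsII] (2.16)–(2.22) pp.225–226, (2.35) p.228; CMP **102** (1985) 277–309 [Balaban1985Variational] (45) p.285,
(143) p.300, (157)–(158) p.302; CMP **95** (1984) 17–40 [Balaban1984PropagatorsI] (1.18), (1.20) p.20.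
-/

set_option autoImplicit false

noncomputable section

open scoped BigOperators Classical

namespace Summit.QuantumFields.YangMills.Theorems.CoverFlatH

open Literature.MathematicalPhysics.QuantumFieldTheory.Balaban1983to89
open LatticeFieldCalculus (siteAvgIter bondAvgIter)
open B6SectADomainsV1 (Domains)
open B6SectAOperatorsV1 (BondIdx)
open B6SectAVectorModelV1 (GE)
open T3ContinuumYM3Torus (T3Family)
open CoverSites (cover proj projBond proj_shift_cast proj_blockOf proj_blockSite_cast)
open CoverDomains (projIdx)
open CoverAverages (bondAvgIter_compR bondAvgIter_pushR siteAvgIter_compR siteAvgIter_pushR)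
open FlatCubeOpsText (IsFlatH IsFlatGt)
open FlatOpsLettersAssembly (flatH IsFlatGW)
open CoverFlatG (GE_cover_of isFlatGW_cover_of)

/-! ## §1 The four average identities at the covering map -/

section Avg

variable (P : Params) (jc : ℕ)

/-- **`Q_k(A ∘ projBond₀) = (Q_k A) ∘ projBond_k`** at the covering map (standing range `k ≤ m + K`). [cite: Balaban1984PropagatorsI, (1.18) p.20] -/
theorem bondAvgIter_comp_proj (A : VecField P 0 ℝ) (k : ℕ) (hk : k ≤ P.m + P.K) (ct : PBond (cover P jc) k) :
    bondAvgIter k (fun b' : PBond (cover P jc) 0 => A ⟨proj P jc 0 b'.src, Fin.cast rfl b'.dir⟩) ct =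
      bondAvgIter k A ⟨proj P jc k ct.src, Fin.cast rfl ct.dir⟩ :=
  bondAvgIter_compR (P := P) (P' := cover P jc) rfl rfl (fun i => proj P jc i) (fun i x μ => proj_shift_cast P jc i rfl x μ)
    (fun i hi y r => proj_blockSite_cast P jc i hi rfl rfl y r) A k hk ct

/-- **`Q_k` OF A FIBRE SUM = THE FIBRE SUM OF `Q_k`** at the covering map. [cite: Balaban1984PropagatorsI, (1.18) p.20] -/
theorem bondAvgIter_push_proj (g : VecField (cover P jc) 0 ℝ) (k : ℕ) (hk : k ≤ P.m + P.K) (y : Site P k) (μ : Fin (cover P jc).d) :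
    bondAvgIter k (fun b : PBond P 0 => ∑ b' : {b' : PBond (cover P jc) 0 // (⟨proj P jc 0 b'.src, Fin.cast rfl b'.dir⟩ : PBond P 0) = b}, g b'.1)
        ⟨y, Fin.cast rfl μ⟩ =
      ∑ y' : {y' : Site (cover P jc) k // proj P jc k y' = y}, bondAvgIter k g ⟨y'.1, μ⟩ :=
  bondAvgIter_pushR (P := P) (P' := cover P jc) rfl rfl (fun i => proj P jc i) (fun i x μ => proj_shift_cast P jc i rfl x μ)
    (fun i hi x => proj_blockOf P jc i hi x) g k hk (le_trans hk (by show P.m + P.K ≤ P.m + jc + P.K; omega)) y μ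

/-- **`Q′_k(f ∘ proj₀) = (Q′_k f) ∘ proj_k`**. [cite: Balaban1984PropagatorsI, (1.20) p.20] -/
theorem siteAvgIter_comp_proj (f : SiteField P 0 ℝ) (k : ℕ) (hk : k ≤ P.m + P.K) :
    siteAvgIter k (f ∘ proj P jc 0) = siteAvgIter k f ∘ proj P jc k :=
  siteAvgIter_compR (P := P) (P' := cover P jc) rfl rfl (fun i => proj P jc i) (fun i hi y r => proj_blockSite_cast P jc i hi rfl rfl y r) f k hk

/-- **`Q′_k` OF A FIBRE SUM = THE FIBRE SUM OF `Q′_k`**. [cite: Balaban1984PropagatorsI, (1.20) p.20] -/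
theorem siteAvgIter_push_proj (g : SiteField (cover P jc) 0 ℝ) (k : ℕ) (hk : k ≤ P.m + P.K) (y : Site P k) :
    siteAvgIter k (fun x => ∑ x' : {x' : Site (cover P jc) 0 // proj P jc 0 x' = x}, g x'.1) y =
      ∑ y' : {y' : Site (cover P jc) k // proj P jc k y' = y}, siteAvgIter k g y'.1 :=
  siteAvgIter_pushR (P := P) (P' := cover P jc) rfl rfl (fun i => proj P jc i) (fun i hi x => proj_blockOf P jc i hi x) g k hk
    (le_trans hk (by show P.m + P.K ≤ P.m + jc + P.K; omega)) y

end Avg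

/-! ## §2 The key lemma of branch (α), unconditional -/

section T3

variable (F : T3Family) (n K : ℕ) (jc : ℕ) (D : Domains (F.P K))

/-- ★★★ **THE KEY LEMMA OF THE (α) BRANCH**: for every member `F`, heights `n, K`, nested family `D` on `F.P K`, cover exponent `jc`, index data `X` and bond `b̃` of the
cover, P2's CANONICAL `H` ((45)∕(157), weights `a ≡ 1`, lattice factor `L^{K−n}`) of the lifted family on periodic data is the periodic extension of the member's:
`flatH (F.cover jc) n K (D.comap jc) (X ∘ projIdx) b̃ = flatH F n K D X (projBond b̃)`. [cite: Balaban1985Variational, (45) p.285, (157) p.302; Balaban1984PropagatorsII, (2.35) p.228] -/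
theorem flatH_cover (X : BondIdx D → ℝ) (bt : PBond (cover (F.P K) jc) 0) :
    flatH (F.cover jc) n K (D.comap jc) (X ∘ projIdx D jc) bt = flatH F n K D X (projBond (F.P K) jc 0 bt) :=
  flatH_cover_of F n K jc D (bondAvgIter_comp_proj (F.P K) jc) (bondAvgIter_push_proj (F.P K) jc) (siteAvgIter_comp_proj (F.P K) jc)
    (siteAvgIter_push_proj (F.P K) jc) X bt

/-- ★ **ANY TWO OPERATORS PINNED BY `IsFlatH`** (`H` on `D`, `Ht` on `D.comap jc`): `Ht (X ∘ projIdx) b̃ = H X (projBond b̃)` — α5's `hH` binder, discharged.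
[cite: Balaban1985Variational, (45) p.285, (157) p.302] -/
theorem isFlatH_cover {H : (BondIdx D → ℝ) →ₗ[ℝ] (PBond (F.P K) 0 → ℝ)} {Ht : (BondIdx (D.comap jc) → ℝ) →ₗ[ℝ] (PBond ((F.cover jc).P K) 0 → ℝ)}
    (hH : IsFlatH F n K D H) (hHt : IsFlatH (F.cover jc) n K (D.comap jc) Ht) (X : BondIdx D → ℝ) (bt : PBond (cover (F.P K) jc) 0) :
    Ht (X ∘ projIdx D jc) bt = H X (projBond (F.P K) jc 0 bt) :=
  isFlatH_cover_of F n K jc D (bondAvgIter_comp_proj (F.P K) jc) (bondAvgIter_push_proj (F.P K) jc) (siteAvgIter_comp_proj (F.P K) jc)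
    (siteAvgIter_push_proj (F.P K) jc) hH hHt X bt

/-- ★ **ANY TWO OPERATORS PINNED BY `IsFlatGt`** (`G̃ = G − HQG`): `Gtt (f ∘ projBond) b̃ = Gt f (projBond b̃)` — α5's `hGt` binder, discharged.
[cite: Balaban1985Variational, (143) p.300, (158) p.302] -/
theorem isFlatGt_cover {Gt : (PBond (F.P K) 0 → ℝ) →ₗ[ℝ] (PBond (F.P K) 0 → ℝ)} {Gtt : (PBond ((F.cover jc).P K) 0 → ℝ) →ₗ[ℝ] (PBond ((F.cover jc).P K) 0 → ℝ)}
    (hG : IsFlatGt F n K D Gt) (hGt : IsFlatGt (F.cover jc) n K (D.comap jc) Gtt) (f : PBond (F.P K) 0 → ℝ) (bt : PBond (cover (F.P K) jc) 0) :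
    Gtt (fun b => f (projBond (F.P K) jc 0 b)) bt = Gt f (projBond (F.P K) jc 0 bt) :=
  isFlatGt_cover_of F n K jc D (bondAvgIter_comp_proj (F.P K) jc) (bondAvgIter_push_proj (F.P K) jc) (siteAvgIter_comp_proj (F.P K) jc)
    (siteAvgIter_push_proj (F.P K) jc) hG hGt f bt

/-- ★ **`GE_cover`**: the genuine propagators `G = Δ_a⁻¹` with weights `w′` ∕ `w′ ∘ projIdx` (lattice factor `L^{K−n}`): `G̃ (f ∘ projBond) b̃ = G f (projBond b̃)`.
[cite: Balaban1984PropagatorsII, (2.16) p.225, (2.22) p.226] -/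
theorem GE_cover {w' : BondIdx D → ℝ} (hw' : ∀ i, 0 < w' i) (f : PBond (F.P K) 0 → ℝ) (bt : PBond (cover (F.P K) jc) 0) :
    GE (D.comap jc) (c := (F.L : ℝ) ^ (K - n)) (pow_ne_zero _ (Nat.cast_ne_zero.2 (F.P K).L_pos.ne')) (w := w' ∘ projIdx D jc)
        (fun i => hw' (projIdx D jc i)) (WithLp.toLp 2 (fun b => f (projBond (F.P K) jc 0 b))) bt =
      GE D (c := (F.L : ℝ) ^ (K - n)) (pow_ne_zero _ (Nat.cast_ne_zero.2 (F.P K).L_pos.ne')) (w := w') hw' (WithLp.toLp 2 f) (projBond (F.P K) jc 0 bt) :=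
  GE_cover_of F n K jc D hw' (bondAvgIter_comp_proj (F.P K) jc) (bondAvgIter_push_proj (F.P K) jc) (siteAvgIter_comp_proj (F.P K) jc)
    (siteAvgIter_push_proj (F.P K) jc) f bt

/-- ★ **ANY TWO PLAIN-FUNCTION PROPAGATORS PINNED BY `IsFlatGW`** (weights `w′` ∕ `w′ ∘ projIdx`). [cite: Balaban1984PropagatorsII, (2.16) p.225, (2.22) p.226] -/
theorem isFlatGW_cover {w' : BondIdx D → ℝ} (hw' : ∀ i, 0 < w' i)
    {G : (PBond (F.P K) 0 → ℝ) →ₗ[ℝ] (PBond (F.P K) 0 → ℝ)} {Gc : (PBond ((F.cover jc).P K) 0 → ℝ) →ₗ[ℝ] (PBond ((F.cover jc).P K) 0 → ℝ)}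
    (hG : IsFlatGW F n K D hw' G) (hGc : IsFlatGW (F.cover jc) n K (D.comap jc) (w' := w' ∘ projIdx D jc) (fun i => hw' (projIdx D jc i)) Gc)
    (f : PBond (F.P K) 0 → ℝ) (bt : PBond (cover (F.P K) jc) 0) :
    Gc (fun b => f (projBond (F.P K) jc 0 b)) bt = G f (projBond (F.P K) jc 0 bt) :=
  isFlatGW_cover_of F n K jc D hw' (bondAvgIter_comp_proj (F.P K) jc) (bondAvgIter_push_proj (F.P K) jc) (siteAvgIter_comp_proj (F.P K) jc)
    (siteAvgIter_push_proj (F.P K) jc) hG hGc f bt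

end T3

end Summit.QuantumFields.YangMills.Theorems.CoverFlatH

end
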